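import Literature.NumberTheory.GaloisRepresentations.IdeleSUnitsClassSequenceInflationDelta
import Literature.NumberTheory.GaloisRepresentations.RestrictedRamificationCycCapLayers
import Literature.NumberTheory.GaloisRepresentations.SUnitsLayerBridgeTransport
import HarnessLib

/-!
# SURJECTIVITY SUPPLY in degree `2`: a class of `H²(Gal(E/F₀), J_{E,S})` that dies in `H²(Gal(E/F₀), C_E)` comes from
# `H²(Gal(E'/F₀), 𝒪ˣ_{E',S})` in a bigger layer `E'` of `K_S` (Neukirch–Schmidt–Wingberg (8.3.11) (ii): exactness of
# `0 → H²(G_S, 𝒪_S^×) → H²(G_S, I_S) → H²(G_S, C_S)` at `H²(G_S, I_S)` — the finite-layer statement)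

Topic `NumberTheory/GaloisRepresentations`; namespaces `Literature.NumberTheory.GaloisRepresentations.IdeleCohomology` (§0–§1, one
tower of number fields) and `Literature.NumberTheory.GaloisRepresentations` (§2, layers of `K_S`).  THEOREMS ONLY (no definition,
no named fact, no `sorry`, no instance).  Lane «TATE-EPC-TC» of cell `bsd-eis` (crux `GoodLatticeBDPValue`,
stmt-BirchSwinnertonDyer-19032; brick B6a, layer half, (F2c)): together with the INJECTIVITY SUPPLY
(`RestrictedRamificationSUnitsLayerInjectivityTwo`) this is the finite-layer content of the EXACT form
«`H²(G_S, 𝒪_S^×) = ker (H²(G_S, I_S) → H²(G_S, C_S))`» of NSW (8.3.11) (ii), read through the local invariants as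
`H²(G_S, 𝒪_S^×)(p) ≅ ker(⊕_{v ∈ S} ℚ_p/ℤ_p → ℚ_p/ℤ_p)` at the limit (not done here).

MATHEMATICS (NSW VIII §3, proof of (8.3.11); Harari §17.4, Prop. 15.40 (a)).  Let `F ⊆ E ⊆ E'` be number fields with `E/F`
Galois, `S` a finite set of finite places of `F`, and assume CAPITULATION: every idèle of `E` lies in `E'ˣ · J_{E',S}` after base
change.  With `G = Gal(E/F)` and the exact sequences (A) `0 → 𝒪ˣ_{E,S} → J_{E,S} → J_{E,S}Eˣ/Eˣ → 0`,
(B) `0 → J_{E,S}Eˣ/Eˣ → C_E → Cl_S(E) → 0`: if `c ∈ H²(G, J_{E,S})` dies in `H²(G, C_E)`, its image `y ∈ H²(G, J_{E,S}Eˣ/Eˣ)`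
dies in `H²(G, C_E)`, so `y = δ_B w` with `w ∈ H¹(G, Cl_S(E))` (exactness of (B)); inflation commutes with `δ_B` and with
`J_S ↠ J_SEˣ/Eˣ` (the morphisms of short exact sequences over `res : Gal(E'/F) ↠ G` of `IdeleSUnitsClassSequenceInflationDelta`),
and `Inf = 0` on `H¹(·, Cl_S)` by capitulation; hence the image of `Inf c` in `H²(Gal(E'/F), J_{E',S}E'ˣ/E'ˣ)` is
`Inf y = δ_B' (Inf w) = 0`, and `Inf c` comes from `H²(Gal(E'/F), 𝒪ˣ_{E',S})` (exactness of (A)).  §2 places this over `K_S`: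
`K` a number field, `S` a set of finite places, `F₀ ≤ E ⊆ K_S` with `E/K` finite Galois, `S₀` the places of `F₀` above `S`; for
`c ∈ H²(Gal(E/F₀), J_{E,S₀})` dying in `H²(Gal(E/F₀), C_E)` there are a finite Galois layer `E′ ⊇ E` of `K_S` (the capitulating
layer, `RestrictedRamificationCycCapLayers.exists_capitulationLayer_sup_ideleS`) and `z ∈ H²(Gal(E′/F₀), 𝒪ˣ_{E′,S})` in the
`S`-UNIT MODEL `SUnits.sUnitsRep K S F₀ E′` whose image under `sUnitsToIdeleS` (this seat's `SUnitsIdeleBridge`) is `Inf c`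
(transport through the natural isomorphism `sUnitsBridgeIso`).

* §0 `IdeleCohomology.ideleSInf_comp_map_ideleSToIdeleSClass` (+ element form) — the `Hⁿ`-square of `J_S ↠ J_SEˣ/Eˣ` with inflation.
* §1 `IdeleCohomology.ideleSClassInf_two_eq_zero_of_map_ideleSClassι_eq_zero` (capitulation kills the classes of `H²(G, J_SEˣ/Eˣ)`
  dying in `H²(G, C_E)`), **`IdeleCohomology.exists_map_sUnitsIdeleι_eq_ideleSInf_of_map_ideleSToClass_eq_zero`** (the SURJECTIVITY
  SUPPLY, one tower).
* §2 **`exists_layer_map_sUnitsToIdeleS_eq_ideleSInf_of_map_ideleSToClass_eq_zero`** — the SURJECTIVITY SUPPLY over `K_S` in the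
  `SUnits.sUnitsRep` / `sUnitsToIdeleS` currency.

HONEST FRAMING: finite-layer statements only (no colimit, no `G_S`-module, no `Nat.card`); proves neither (8.3.11) (ii) for `G_S` nor
any statement of a Summit; no case of BSD is advanced by this file alone; 0 cells / labels / tiers move.

## References
* J. Neukirch, A. Schmidt, K. Wingberg, *Cohomology of Number Fields*, 2nd ed. (2008), VIII §3, (8.3.11) (ii) and its proof
  («`Cl_S(k_S) = 0`»). [NeukirchSchmidtWingberg2008]
* D. Harari, *Galois Cohomology and Class Field Theory*, Universitext, Springer (2020), §17.4 (17.1), Prop. 15.40 (a), Lemma 15.39.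
  [Harari2020]
* J. W. S. Cassels, A. Fröhlich (eds.), *Algebraic Number Theory* (1967), Ch. VII (J. Tate) §11.1. [CasselsFrohlichANT1967]
-/

noncomputable section

open NumberField IsDedekindDomain Field IntermediateField CategoryTheory groupCohomology
open Literature.NumberTheory.GaloisRepresentations.OpenSubgroupLayer (algOfLE isScalarTower_algOfLE)
open Literature.NumberTheory.GaloisRepresentations.LocalWeilDatum
open Literature.NumberTheory.Automorphic

namespace Literature.NumberTheory.GaloisRepresentations

namespace IdeleCohomology

open Literature.Algebra.Homology

/-! ## §0. The `Hⁿ`-square of `J_{·,S} ↠ J_{·,S}·ˣ/·ˣ` with inflation -/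

section Square

variable {F E E' : Type} [Field F] [NumberField F] [Field E] [NumberField E] [Field E'] [NumberField E']
  [Algebra F E] [Algebra E E'] [Algebra F E'] [IsScalarTower F E E'] [Normal F E]
variable (S : Finset (HeightOneSpectrum (𝓞 F)))

/-- **`Inf ∘ Hⁿ(J_{E,S} ↠ J_{E,S}Eˣ/Eˣ) = Hⁿ(J_{E',S} ↠ J_{E',S}E'ˣ/E'ˣ) ∘ Inf`** (functoriality of `Hⁿ` on the square
`res_ideleSToIdeleSClass_comp_ideleSClassInflHom`). [cite: CasselsFrohlichANT1967, Ch. VII §11.1]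
[cite: NeukirchSchmidtWingberg2008, VIII §3 (8.3.9)] -/
theorem ideleSInf_comp_map_ideleSToIdeleSClass (n : ℕ) :
    ideleSInf F E E' S n ≫ groupCohomology.map (MonoidHom.id _) (ideleSToIdeleSClass S) n =
      groupCohomology.map (MonoidHom.id _) (ideleSToIdeleSClass S) n ≫ ideleSClassInf F E E' S n := by
  rw [ideleSInf, ideleSClassInf, ← groupCohomology.map_comp, ← groupCohomology.map_comp]
  exact map_congr' (by rw [MonoidHom.id_comp, MonoidHom.comp_id]) _ _
    (fun x => (congrArg (fun φ => φ.hom x)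
      (res_ideleSToIdeleSClass_comp_ideleSClassInflHom (F := F) (E := E) (E' := E') S)).symm) n

/-- Element form of `ideleSInf_comp_map_ideleSToIdeleSClass`. [cite: CasselsFrohlichANT1967, Ch. VII §11.1] -/
theorem map_ideleSToIdeleSClass_ideleSInf (n : ℕ) (c : groupCohomology (ideleSRep F E S) n) :
    groupCohomology.map (MonoidHom.id _) (ideleSToIdeleSClass S) n (ideleSInf F E E' S n c) =
      ideleSClassInf F E E' S n (groupCohomology.map (MonoidHom.id _) (ideleSToIdeleSClass S) n c) := by
  have h := congrArg (fun φ => φ c) (ideleSInf_comp_map_ideleSToIdeleSClass (F := F) (E := E) (E' := E') S n)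
  simpa only [ModuleCat.hom_comp, LinearMap.coe_comp, Function.comp_apply] using h

end Square

/-! ## §1. One tower `F ⊆ E ⊆ E'`: the classes of `H²(G, J_{E,S})` dying in `H²(G, C_E)` come from `H²(Gal(E'/F), 𝒪ˣ_{E',S})` -/

section Tower

variable {F E E' : Type} [Field F] [NumberField F] [Field E] [NumberField E] [Field E'] [NumberField E']
  [Algebra F E] [Algebra E E'] [Algebra F E'] [IsScalarTower F E E'] [IsGalois F E]
variable (S : Finset (HeightOneSpectrum (𝓞 F)))

/-- **Capitulation kills the classes of `H²(G, J_{E,S}Eˣ/Eˣ)` that die in `H²(G, C_E)`**: such a class is `δ_B w`,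
`w ∈ H¹(G, Cl_S(E))` (exactness of (B), `exists_δ_sClass_one_eq`), and `Inf (δ_B w) = δ_B' (Inf w) = 0` since `Inf = 0` on
`H¹(·, Cl_S)` under capitulation. [cite: NeukirchSchmidtWingberg2008, VIII §3 (8.3.11) (ii) (proof)][cite: Harari2020, Prop. 15.40 (a)] -/
theorem ideleSClassInf_two_eq_zero_of_map_ideleSClassι_eq_zero
    (hcap : ∀ a : ideleGroup E, AdeleRing.ideleBaseChange E E' a ∈ principalIdeles E' ⊔ ideleS F E' S)
    (y : groupCohomology (ideleSClassRep F E S) 2)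
    (hy : groupCohomology.map (MonoidHom.id _) (ideleSClassι S) 2 y = 0) :
    ideleSClassInf F E E' S 2 y = 0 := by
  obtain ⟨w, rfl⟩ := exists_δ_sClass_one_eq S y hy
  rw [ideleSClassInf_δ_apply S 1 2 rfl, sClassGroupInf_eq_zero_of_forall_mem_sup S hcap 1]
  simp only [ModuleCat.hom_zero, LinearMap.zero_apply]
  exact map_zero _

/-- **SURJECTIVITY SUPPLY, one tower (NSW (8.3.11) (ii) proof, finite layers).**  `F ⊆ E ⊆ E'` number fields, `E/F` Galois, `S` a
finite set of finite places of `F`; assume CAPITULATION: the base change of every idèle of `E` lies in `E'ˣ · J_{E',S}`.  Then for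
every `c ∈ H²(Gal(E/F), J_{E,S})` whose image in `H²(Gal(E/F), C_E)` vanishes, `Inf c ∈ H²(Gal(E'/F), J_{E',S})` is the image of
a class of `H²(Gal(E'/F), 𝒪ˣ_{E',S})`: the image `y` of `c` in `H²(G, J_{E,S}Eˣ/Eˣ)` dies in `H²(G, C_E)`
(`J_S ↠ J_SEˣ/Eˣ ↪ C_E` is `J_S → C_E`), `Inf y = 0` (previous theorem), `Inf y` is the image of `Inf c` (§0), and (A) is exact
at `H²(J_{E',S})` (`exists_map_sUnitsIdeleι_two_eq`).
[cite: NeukirchSchmidtWingberg2008, VIII §3 (8.3.11) (ii) (proof)][cite: Harari2020, §17.4 (17.1), Prop. 15.40 (a)] -/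
theorem exists_map_sUnitsIdeleι_eq_ideleSInf_of_map_ideleSToClass_eq_zero
    (hcap : ∀ a : ideleGroup E, AdeleRing.ideleBaseChange E E' a ∈ principalIdeles E' ⊔ ideleS F E' S)
    (c : groupCohomology (ideleSRep F E S) 2)
    (hc : groupCohomology.map (MonoidHom.id _) (ideleSToClass S) 2 c = 0) :
    ∃ x' : groupCohomology (sUnitsIdeleRep F E' S) 2,
      groupCohomology.map (MonoidHom.id _) (sUnitsIdeleι S) 2 x' = ideleSInf F E E' S 2 c := by
  -- the image `y` of `c` in `H²(G, J_{E,S}Eˣ/Eˣ)` dies in `H²(G, C_E)`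
  have h := congrArg (fun φ => φ c)
    (groupCohomology.map_id_comp (ideleSToIdeleSClass (F := F) (E := E) S) (ideleSClassι S) 2)
  simp only [ideleSToIdeleSClass_comp_ι, ModuleCat.hom_comp, LinearMap.coe_comp, Function.comp_apply] at h
  have hy : groupCohomology.map (MonoidHom.id _) (ideleSClassι S) 2
      (groupCohomology.map (MonoidHom.id _) (ideleSToIdeleSClass S) 2 c) = 0 := h.symm.trans hc
  -- `Inf y = 0`, and `Inf y` is the image of `Inf c`
  have h0 := ideleSClassInf_two_eq_zero_of_map_ideleSClassι_eq_zero S hcap _ hy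
  have sq := map_ideleSToIdeleSClass_ideleSInf (F := F) (E := E) (E' := E') S 2 c
  -- exactness of (A) at `H²(Gal(E'/F), J_{E',S})`
  exact exists_map_sUnitsIdeleι_two_eq S (ideleSInf F E E' S 2 c) (sq.trans h0)

end Tower

end IdeleCohomology

/-! ## §2. Over `K_S`: the surjectivity supply statement in the `SUnits.sUnitsRep` / `sUnitsToIdeleS` currency -/

variable {K : Type} [Field K] [NumberField K] (S : Set (HeightOneSpectrum (𝓞 K)))

/-- **SURJECTIVITY SUPPLY, degree `2` (NSW (8.3.11) (ii) at finite layers, `S`-unit model).**  `K` a number field, `S` a set of finite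
places of `K`, `F₀ ≤ E ⊆ K_S` with `E/K` finite Galois, `S₀` the finite set of places of `F₀` above `S`.  For every
`c ∈ H²(Gal(E/F₀), J_{E,S₀})` whose image in `H²(Gal(E/F₀), C_E)` vanishes there are a finite Galois layer `E′ ⊇ E` inside `K_S` and
`z ∈ H²(Gal(E′/F₀), 𝒪ˣ_{E′,S})` (the `S`-unit model `SUnits.sUnitsRep K S F₀ E′`) whose image under `𝒪ˣ_{E′,S} → J_{E′,S₀}` (this
seat's `sUnitsToIdeleS`) is `Inf c` (all algebras = inclusions).  `E′ :=` the capitulating layer of `exists_capitulationLayer_sup_ideleS`;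
the class is `IdeleCohomology.exists_map_sUnitsIdeleι_eq_ideleSInf_of_map_ideleSToClass_eq_zero` transported through the natural
isomorphism `IdeleCohomology.sUnitsBridgeIso` (`sUnitsBridge ≫ sUnitsIdeleι = sUnitsToIdeleS`).
[cite: NeukirchSchmidtWingberg2008, VIII §3 (8.3.11) (ii) (proof)][cite: Harari2020, §17.4 (17.1), Prop. 15.40 (a)] -/
theorem exists_layer_map_sUnitsToIdeleS_eq_ideleSInf_of_map_ideleSToClass_eq_zero
    {F₀ E : IntermediateField K (AlgebraicClosure K)} [FiniteDimensional K E] [IsGalois K E] (hF : F₀ ≤ E)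
    (hS : ramificationSubgroup K S ≤ galFixing K E)
    (S₀ : Finset (HeightOneSpectrum (𝓞 F₀))) (hSF : ∀ u : HeightOneSpectrum (𝓞 F₀), u ∈ S₀ ↔ u.under (𝓞 K) ∈ S)
    (c : letI := algOfLE hF
      haveI : FiniteDimensional K F₀ :=
        FiniteDimensional.of_injective (IntermediateField.inclusion hF).toLinearMap (IntermediateField.inclusion hF).injective
      haveI : NumberField F₀ := NumberField.of_module_finite K F₀
      haveI : NumberField E := NumberField.of_module_finite K E
      groupCohomology (IdeleCohomology.ideleSRep F₀ E S₀) 2)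
    (hc : letI := algOfLE hF
      haveI : FiniteDimensional K F₀ :=
        FiniteDimensional.of_injective (IntermediateField.inclusion hF).toLinearMap (IntermediateField.inclusion hF).injective
      haveI : NumberField F₀ := NumberField.of_module_finite K F₀
      haveI : NumberField E := NumberField.of_module_finite K E
      groupCohomology.map (MonoidHom.id (E ≃ₐ[F₀] E)) (A := IdeleCohomology.ideleSRep F₀ E S₀)
        (B := IdeleClassGroup.galoisRep F₀ E) (IdeleCohomology.ideleSToClass S₀) 2 c = 0) :
    ∃ (E' : IntermediateField K (AlgebraicClosure K)) (_ : FiniteDimensional K E') (_ : IsGalois K E') (hEE' : E ≤ E')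
      (_ : ramificationSubgroup K S ≤ galFixing K E'),
      letI := algOfLE hF
      letI := algOfLE hEE'
      letI := algOfLE (hF.trans hEE')
      haveI : FiniteDimensional K F₀ :=
        FiniteDimensional.of_injective (IntermediateField.inclusion hF).toLinearMap (IntermediateField.inclusion hF).injective
      haveI : NumberField F₀ := NumberField.of_module_finite K F₀
      haveI : NumberField E := NumberField.of_module_finite K E
      haveI : NumberField E' := NumberField.of_module_finite K E'
      haveI := isScalarTower_algOfLE (K := K) hF
      haveI := isScalarTower_algOfLE (K := K) (hF.trans hEE')
      haveI : IsScalarTower F₀ E E' := IsScalarTower.of_algebraMap_eq fun _ => rfl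
      haveI : IsGalois F₀ E := IsGalois.tower_top_of_isGalois K F₀ E
      ∃ z : groupCohomology (SUnits.sUnitsRep K S F₀ E') 2,
        groupCohomology.map (MonoidHom.id (E' ≃ₐ[F₀] E')) (A := SUnits.sUnitsRep K S F₀ E')
            (B := IdeleCohomology.ideleSRep F₀ E' S₀) (IdeleCohomology.sUnitsToIdeleS (K := K) (F := F₀) (E := E') S S₀ hSF) 2 z =
          IdeleCohomology.ideleSInf F₀ E E' S₀ 2 c := by
  classical
  -- the base `F₀` and the layer `E` over it
  letI := algOfLE hF
  haveI := isScalarTower_algOfLE (K := K) hF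
  haveI : FiniteDimensional K F₀ :=
    FiniteDimensional.of_injective (IntermediateField.inclusion hF).toLinearMap (IntermediateField.inclusion hF).injective
  haveI : NumberField F₀ := NumberField.of_module_finite K F₀
  haveI : NumberField E := NumberField.of_module_finite K E
  haveI : IsGalois F₀ E := IsGalois.tower_top_of_isGalois K F₀ E
  -- the capitulating layer `E ≤ E₂ ⊆ K_S`
  obtain ⟨E₂, h₂, hfin₂, hgal₂, hS₂, hcap⟩ := exists_capitulationLayer_sup_ideleS S hF hS S₀
  refine ⟨E₂, hfin₂, hgal₂, h₂, hS₂, ?_⟩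
  letI := algOfLE h₂
  letI := algOfLE (hF.trans h₂)
  haveI : NumberField E₂ := NumberField.of_module_finite K E₂
  haveI := isScalarTower_algOfLE (K := K) h₂
  haveI := isScalarTower_algOfLE (K := K) (hF.trans h₂)
  haveI : IsScalarTower F₀ E E₂ := IsScalarTower.of_algebraMap_eq fun _ => rfl
  haveI : IsGalois F₀ E₂ := IsGalois.tower_top_of_isGalois K F₀ E₂
  -- §1 in the tower `F₀ ⊆ E ⊆ E₂`: `Inf c = H²(ι) x'` for a class `x'` of the principal `S₀`-idèles of `E₂`
  obtain ⟨x', hx'⟩ :=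
    IdeleCohomology.exists_map_sUnitsIdeleι_eq_ideleSInf_of_map_ideleSToClass_eq_zero (F := F₀) (E := E) (E' := E₂) S₀ hcap c hc
  -- transport through the bridge isomorphism `𝒪ˣ_{E₂,S} ≅ principal S₀-idèles`
  refine ⟨groupCohomology.map (MonoidHom.id (E₂ ≃ₐ[F₀] E₂)) (A := IdeleCohomology.sUnitsIdeleRep F₀ E₂ S₀)
    (B := SUnits.sUnitsRep K S F₀ E₂) (IdeleCohomology.sUnitsBridgeIso (K := K) (F := F₀) (E := E₂) S S₀ hSF).inv 2 x', ?_⟩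
  have hcomp : (IdeleCohomology.sUnitsBridgeIso (K := K) (F := F₀) (E := E₂) S S₀ hSF).inv ≫
      IdeleCohomology.sUnitsToIdeleS (K := K) (F := F₀) (E := E₂) S S₀ hSF = IdeleCohomology.sUnitsIdeleι S₀ := by
    rw [← IdeleCohomology.sUnitsBridge_comp_ι, ← IdeleCohomology.sUnitsBridgeIso_hom, Iso.inv_hom_id_assoc]
  have h := congrArg (fun φ => φ x')
    (groupCohomology.map_id_comp (IdeleCohomology.sUnitsBridgeIso (K := K) (F := F₀) (E := E₂) S S₀ hSF).inv
      (IdeleCohomology.sUnitsToIdeleS (K := K) (F := F₀) (E := E₂) S S₀ hSF) 2)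
  simp only [hcomp, ModuleCat.hom_comp, LinearMap.coe_comp, Function.comp_apply] at h
  exact h.symm.trans hx'

end Literature.NumberTheory.GaloisRepresentations

end
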